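import Mathlib
import Literature.Analysis.FunctionSpaces.PlancherelL1L2
import Summits.NavierStokesRegularity.NavierStokesRegularity.Theorems.FilamentSkeletonRssClause13BandVirialTools
import Summits.NavierStokesRegularity.NavierStokesRegularity.Theorems.FilamentSkeletonRssClause13KernelVirial

/-!
# Clause 13-J/13-R, brick B5 (band virial, ASSEMBLY): the virial identity of the model self operator on the symbol side,
# `i∫∫K_q(τ−σ)Y(σ)conj Y(τ)(τ−c) + conj(…) = −(1/(π√q)) ∫ 𝔖′(z√q) |Ŷ(z)|² dz`

Route `FilamentSkeletonRss`, ∃-side clause 13 (`Clause13RNearStraightL` stmt-NavierStokesRegularity-23612 = A1R twin of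
`Clause13NearStraightL` 23321; typing-agnostic); design of record `filament-plan/DESIGN-NOTE-28296-tenure-g22.md` §4
("2Re⟨DT·Y, (τ−c)Y⟩ = −(Γγ_j/(2πμ))·⟨Y, 𝔖′(μD)Y⟩ + …: the Mourre estimate is a 3-line virial identity in L²").  This file
ASSEMBLES the band virial of the MODEL self operator `M_q = (2/q)·I − K_q∗` (B2, `K_q(s) = (2q−s²)(s²+q)^{-5/2}`, symbol
`(2/q)𝔖(z√q)`, p665821) from the landed pieces — the physical-space identity `…Clause13KernelVirial` (p670953), the Plancherel
machinery of p665209 in its polarised form and the tools of `…Clause13BandVirialTools` (`|𝔖′| ≤ π`, `F′ = iG`):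

* §4 `integral_prod_commutatorKernel` — THE COMMUTATOR FORM: for `f ∈ L¹ ∩ L²`, `x·f ∈ L¹`,
  `∫∫ (t−u)K_q(t−u) f(u) conj f(t) = i·(1/2π)·∫ (2/q)√q·𝔖′(z√q)|F(z)|² dz`
  (polarise with `g = x·f`: `(t−u)K f(u)conj f(t) = K f(u)conj g(t) − K g(u)conj f(t)`; `F conj G − G conj F = i(conj F·F)′`
  since `F′ = iG`; integrate by parts against `m_q`, `m_q′(z) = −(2/q)√q·𝔖′(z√q)`; boundary-free version
  `integral_mul_deriv_eq_deriv_mul_of_integrable`, all three products integrable because `m_q ∈ L¹`, `|m_q′| ≤ (2/q)√q·π`,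
  `|F|² ∈ L¹` (Plancherel), `F, G` bounded);
* §5 `band_virial_identity` — with p670953: `i∫_{ℝ²}K_q(τ−σ)Y(σ)conj Y(τ)(τ−c) + conj(…) = −(1/(π√q))∫𝔖′(z√q)|Ŷ(z)|²dz` for
  continuous `Y ∈ L¹ ∩ L²` with `x·Y ∈ L¹` (the `(2/q)·I` part of `M_q` drops by p670953's `I_mul_real_add_conj`, so this IS
  `−2Re⟨iM_qY,(τ−c)Y⟩` up to the model constant); and `band_virial_ge_of_slice` — if `Ŷ` vanishes where `𝔖′(z√q) < σ₀`
  then `(1/(π√q))∫𝔖′(z√q)|Ŷ|² ≥ (2σ₀/√q)·∫‖Y‖²` (Plancherel): the band GAIN of the design's Mourre estimate in the model case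
  (`𝔖′ ≥ ½𝔖′(x*) > 0` on the band is the numerical input the design quotes; not used here).

Lane ns-filament-19175-p1 g15; `--supports stmt-NavierStokesRegularity-23612 --as helper`.
HONEST FRAMING: harmonic analysis of an explicit model kernel attached to a HYPOTHETICAL filament skeleton on the NEGATIVE side of a
MODEL route; nothing here bears on Navier–Stokes regularity or blow-up; 23610/23611/23612/23320 stay OPEN.
-/

noncomputable section

open MeasureTheory Real Complex Filter Set
open scoped FourierTransform ComplexConjugate Topology
open Summit.NavierStokesRegularity.NavierStokesRegularity.Theorems.AnalyticStripLiaSymbol (liaSym liaSym_neg liaSym_zero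
  one_sub_liaSym_nonneg one_sub_liaSym_le_exp)

namespace Summit.NavierStokesRegularity.NavierStokesRegularity.Theorems.MatchedKernel
set_option linter.dupNamespace false

/-! ## §4 The commutator kernel's quadratic form on the symbol side -/

/-- Derivative of the multiplier `m_q(z) = (2/q)(1 − 𝔖(z√q))`: `m_q′(z) = −(2/q)√q·𝔖′(z√q)`. [folklore] -/
theorem hasDerivAt_smoothingMultiplier {q : ℝ} (z : ℝ) :
    HasDerivAt (fun z : ℝ => (((2 / q * (1 - liaSym (z * √q))) : ℝ) : ℂ))
      (((-(2 / q) * (√q * deriv liaSym (z * √q)) : ℝ) : ℂ)) z := by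
  have hin : HasDerivAt (fun z : ℝ => z * √q) (√q) z := by
    simpa using (hasDerivAt_id z).mul_const (√q)
  have hS : HasDerivAt liaSym (deriv liaSym (z * √q)) (z * √q) := (differentiable_liaSym _).hasDerivAt
  have hcomp : HasDerivAt (fun z : ℝ => liaSym (z * √q)) (deriv liaSym (z * √q) * √q) z := by
    have h : HasDerivAt (liaSym ∘ fun z : ℝ => z * √q) (deriv liaSym (z * √q) * √q) z := hS.comp z hin
    exact h
  have hreal : HasDerivAt (fun z : ℝ => 2 / q * (1 - liaSym (z * √q)))
      (-(2 / q) * (√q * deriv liaSym (z * √q))) z := by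
    refine ((hcomp.const_sub 1).const_mul (2 / q)).congr_deriv ?_
    ring
  exact hreal.ofReal_comp

/-- **THE COMMUTATOR FORM.**  For `q > 0` and `f ∈ L¹ ∩ L²(ℝ; ℂ)` with `x·f ∈ L¹`, writing `F(z) = ∫ f(x)e^{izx}dx`:
`∫_{ℝ×ℝ} (t−u)K_q(t−u) f(u) conj f(t) d(t,u) = i·(1/2π)·∫ (2/q)√q·𝔖′(z√q)·|F(z)|² dz`
(`(2/q)√q = 2/√q`): the quadratic form of the kernel of `[(τ−c), K_q∗]` is `i` times the spectral integral against the
DERIVATIVE of the symbol. [folklore] -/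
theorem integral_prod_commutatorKernel {q : ℝ} (hq : 0 < q) {f : ℝ → ℂ} (hf : Integrable f) (hf2 : MemLp f 2)
    (hxf : Integrable (fun x : ℝ => x • f x)) :
    ∫ p : ℝ × ℝ, ((((p.1 - p.2) * ((2 * q - (p.1 - p.2) ^ 2) * (((p.1 - p.2) ^ 2 + q) ^ (5 / 2 : ℝ))⁻¹) : ℝ)) : ℂ)
        * (f p.2 * conj (f p.1)) ∂(volume.prod volume)
      = I * (((1 / (2 * π)) * ∫ z : ℝ, (2 / q * (√q * deriv liaSym (z * √q)))
          * ‖∫ x : ℝ, f x * cexp (I * z * x)‖ ^ 2 : ℝ) : ℂ) := by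
  -- the first moment `g = x·f`
  set g : ℝ → ℂ := fun x => (x : ℂ) * f x with hgdef
  have hg : Integrable g := hxf.congr (Eventually.of_forall fun x => by simp [hgdef, Complex.real_smul])
  -- names for the transforms
  set F : ℝ → ℂ := fun z => ∫ x : ℝ, f x * cexp (I * z * x) with hFdef
  set G : ℝ → ℂ := fun z => ∫ x : ℝ, g x * cexp (I * z * x) with hGdef
  have hFc : Continuous F := continuous_unnormalisedTransform hf
  have hGc : Continuous G := continuous_unnormalisedTransform hg
  have hFb : ∀ z, ‖F z‖ ≤ ∫ x : ℝ, ‖f x‖ := fun z => norm_unnormalisedTransform_le z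
  have hGb : ∀ z, ‖G z‖ ≤ ∫ x : ℝ, ‖g x‖ := fun z => norm_unnormalisedTransform_le z
  have hFd : ∀ z, HasDerivAt F (I * G z) z := fun z => hasDerivAt_unnormalisedTransform hf hxf z
  -- STEP 1: polarisation `(t−u)K f(u)conj f(t) = K f(u) conj(g t) − K g(u) conj f(t)`
  have hK_bd : ∀ p : ℝ × ℝ, ‖((((2 * q - (p.1 - p.2) ^ 2) * (((p.1 - p.2) ^ 2 + q) ^ (5 / 2 : ℝ))⁻¹ : ℝ)) : ℂ)‖
      ≤ 2 * (q ^ (3 / 2 : ℝ))⁻¹ := by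
    intro p
    rw [Complex.norm_real, Real.norm_eq_abs]
    refine (abs_smoothingKernel_le hq (p.1 - p.2)).trans ?_
    have hq32 : 0 < q ^ (3 / 2 : ℝ) := Real.rpow_pos_of_pos hq _
    have hle : q ^ (3 / 2 : ℝ) ≤ ((p.1 - p.2) ^ 2 + q) ^ (3 / 2 : ℝ) :=
      Real.rpow_le_rpow hq.le (by nlinarith [sq_nonneg (p.1 - p.2)]) (by norm_num)
    have := inv_anti₀ hq32 hle
    linarith
  have hKm : AEStronglyMeasurable (fun p : ℝ × ℝ =>
      ((((2 * q - (p.1 - p.2) ^ 2) * (((p.1 - p.2) ^ 2 + q) ^ (5 / 2 : ℝ))⁻¹ : ℝ)) : ℂ)) (volume.prod volume) := by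
    refine Continuous.aestronglyMeasurable ?_
    exact Complex.continuous_ofReal.comp ((continuous_smoothingKernel hq).comp (continuous_fst.sub continuous_snd))
  have hint1 : Integrable (fun p : ℝ × ℝ =>
      ((((2 * q - (p.1 - p.2) ^ 2) * (((p.1 - p.2) ^ 2 + q) ^ (5 / 2 : ℝ))⁻¹ : ℝ)) : ℂ) * f p.2 * conj (g p.1))
      (volume.prod volume) := by
    refine ((integrable_prod_mul_conj hf hg).bdd_mul hKm (c := 2 * (q ^ (3 / 2 : ℝ))⁻¹)
      (Eventually.of_forall hK_bd)).congr (Eventually.of_forall fun p => ?_)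
    simp only; ring
  have hint2 : Integrable (fun p : ℝ × ℝ =>
      ((((2 * q - (p.1 - p.2) ^ 2) * (((p.1 - p.2) ^ 2 + q) ^ (5 / 2 : ℝ))⁻¹ : ℝ)) : ℂ) * g p.2 * conj (f p.1))
      (volume.prod volume) := by
    refine ((integrable_prod_mul_conj hg hf).bdd_mul hKm (c := 2 * (q ^ (3 / 2 : ℝ))⁻¹)
      (Eventually.of_forall hK_bd)).congr (Eventually.of_forall fun p => ?_)
    simp only; ring
  have hpol : ∀ p : ℝ × ℝ,
      ((((p.1 - p.2) * ((2 * q - (p.1 - p.2) ^ 2) * (((p.1 - p.2) ^ 2 + q) ^ (5 / 2 : ℝ))⁻¹) : ℝ)) : ℂ)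
        * (f p.2 * conj (f p.1))
      = ((((2 * q - (p.1 - p.2) ^ 2) * (((p.1 - p.2) ^ 2 + q) ^ (5 / 2 : ℝ))⁻¹ : ℝ)) : ℂ) * f p.2 * conj (g p.1)
        - ((((2 * q - (p.1 - p.2) ^ 2) * (((p.1 - p.2) ^ 2 + q) ^ (5 / 2 : ℝ))⁻¹ : ℝ)) : ℂ) * g p.2 * conj (f p.1) := by
    intro p
    simp only [hgdef, map_mul, Complex.conj_ofReal]
    push_cast
    ring
  simp_rw [hpol]
  rw [integral_sub hint1 hint2, integral_prod_smoothingKernel_sub_polar hq hf hg,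
    integral_prod_smoothingKernel_sub_polar hq hg hf]
  -- STEP 2: `F conj G − G conj F = i·(conj F·F)′`
  set m : ℝ → ℂ := fun z => (((2 / q * (1 - liaSym (z * √q))) : ℝ) : ℂ) with hmdef
  set m' : ℝ → ℂ := fun z => (((-(2 / q) * (√q * deriv liaSym (z * √q))) : ℝ) : ℂ) with hm'def
  set v : ℝ → ℂ := fun z => conj (F z) * F z with hvdef
  set v' : ℝ → ℂ := fun z => I * (G z * conj (F z) - F z * conj (G z)) with hv'def
  have hv : ∀ z, HasDerivAt v (v' z) z := by
    intro z
    have h := ((hFd z).star).mul (hFd z)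
    refine h.congr_deriv ?_
    simp only [hv'def, star_mul', Complex.star_def, Complex.conj_I]
    ring
  have hm : ∀ z, HasDerivAt m (m' z) z := fun z => hasDerivAt_smoothingMultiplier z
  -- integrability bookkeeping
  have hmi : Integrable m := integrable_multiplier hq
  have hm'b : ∀ z, ‖m' z‖ ≤ 2 / q * (√q * π) := by
    intro z
    simp only [hm'def, Complex.norm_real, Real.norm_eq_abs, neg_mul, abs_neg, abs_mul, abs_of_pos
      (by positivity : (0:ℝ) < 2 / q), abs_of_nonneg (Real.sqrt_nonneg q)]
    gcongr
    exact abs_deriv_liaSym_le _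
  have hm'm : AEStronglyMeasurable m' volume := by
    have hmeas : Measurable (fun z : ℝ => deriv liaSym (z * √q)) :=
      (measurable_deriv liaSym).comp (measurable_id.mul_const _)
    exact (Complex.measurable_ofReal.comp ((hmeas.const_mul _).const_mul _)).aestronglyMeasurable
  have hvb : ∀ z, ‖v z‖ ≤ (∫ x : ℝ, ‖f x‖) * ∫ x : ℝ, ‖f x‖ := by
    intro z
    simp only [hvdef, norm_mul, Complex.norm_conj]
    exact mul_le_mul (hFb z) (hFb z) (norm_nonneg _) (integral_nonneg fun _ => norm_nonneg _)
  have hvc : Continuous v := (Complex.continuous_conj.comp hFc).mul hFc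
  have hv'b : ∀ z, ‖v' z‖ ≤ 2 * ((∫ x : ℝ, ‖g x‖) * ∫ x : ℝ, ‖f x‖) := by
    intro z
    simp only [hv'def, norm_mul, Complex.norm_I, one_mul]
    refine (norm_sub_le _ _).trans ?_
    rw [norm_mul, norm_mul, Complex.norm_conj, Complex.norm_conj, two_mul]
    exact add_le_add (mul_le_mul (hGb z) (hFb z) (norm_nonneg _) (integral_nonneg fun _ => norm_nonneg _))
      (by rw [mul_comm]; exact mul_le_mul (hGb z) (hFb z) (norm_nonneg _) (integral_nonneg fun _ => norm_nonneg _))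
  have hv'c : Continuous v' :=
    continuous_const.mul ((hGc.mul (Complex.continuous_conj.comp hFc)).sub (hFc.mul (Complex.continuous_conj.comp hGc)))
  have huv' : Integrable (m * v') := by
    rw [mul_comm]; exact hmi.bdd_mul hv'c.aestronglyMeasurable (Eventually.of_forall hv'b)
  have huv : Integrable (m * v) := by
    rw [mul_comm]; exact hmi.bdd_mul hvc.aestronglyMeasurable (Eventually.of_forall hvb)
  have hvi : Integrable v := by
    have h := (integrable_norm_sq_unnormalisedTransform hf hf2).ofReal (𝕜 := ℂ)
    refine h.congr (Eventually.of_forall fun z => ?_)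
    show ((‖F z‖ ^ 2 : ℝ) : ℂ) = conj (F z) * F z
    rw [Complex.conj_mul', Complex.ofReal_pow]
  have hu'v : Integrable (m' * v) := by
    have h := hvi.bdd_mul hm'm (Eventually.of_forall hm'b)
    exact h
  -- STEP 3: integrate by parts against the multiplier
  have hparts := integral_mul_deriv_eq_deriv_mul_of_integrable (u := m) (v := v) (u' := m') (v' := v')
    (fun z _ => hm z) (fun z _ => hv z) huv' hu'v huv
  -- assemble
  have hmc : Continuous m :=
    Complex.continuous_ofReal.comp (continuous_const.mul (continuous_const.sub
      (continuous_liaSym.comp (continuous_id.mul continuous_const))))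
  have hdiff : (1 / (2 * π) : ℝ) * (∫ z : ℝ, m z * (F z * conj (G z)))
      - (1 / (2 * π) : ℝ) * (∫ z : ℝ, m z * (G z * conj (F z)))
      = -((1 / (2 * π) : ℝ) : ℂ) * I⁻¹ * ∫ z : ℝ, m z * v' z := by
    have hi1 : Integrable (fun z => m z * (F z * conj (G z))) := by
      refine (hmi.norm.mul_const ((∫ x : ℝ, ‖f x‖) * ∫ x : ℝ, ‖g x‖)).mono'
        (hmc.mul (hFc.mul (Complex.continuous_conj.comp hGc))).aestronglyMeasurable
        (Eventually.of_forall fun z => ?_)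
      rw [norm_mul, norm_mul, Complex.norm_conj]
      exact mul_le_mul_of_nonneg_left (mul_le_mul (hFb z) (hGb z) (norm_nonneg _)
        (integral_nonneg fun _ => norm_nonneg _)) (norm_nonneg _)
    have hi2 : Integrable (fun z => m z * (G z * conj (F z))) := by
      refine (hmi.norm.mul_const ((∫ x : ℝ, ‖g x‖) * ∫ x : ℝ, ‖f x‖)).mono'
        (hmc.mul (hGc.mul (Complex.continuous_conj.comp hFc))).aestronglyMeasurable
        (Eventually.of_forall fun z => ?_)
      rw [norm_mul, norm_mul, Complex.norm_conj]
      exact mul_le_mul_of_nonneg_left (mul_le_mul (hGb z) (hFb z) (norm_nonneg _)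
        (integral_nonneg fun _ => norm_nonneg _)) (norm_nonneg _)
    rw [← mul_sub, ← integral_sub hi1 hi2]
    have hpt : ∀ z, m z * (F z * conj (G z)) - m z * (G z * conj (F z)) = -I⁻¹ * (m z * v' z) := by
      intro z
      simp only [hv'def, Complex.inv_I]
      ring_nf
      rw [Complex.I_sq]
      ring
    rw [integral_congr_ae (Eventually.of_forall hpt), integral_const_mul]
    ring
  show (1 / (2 * π) : ℝ) * (∫ z : ℝ, m z * (F z * conj (G z)))
      - (1 / (2 * π) : ℝ) * (∫ z : ℝ, m z * (G z * conj (F z)))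
      = I * (((1 / (2 * π)) * ∫ z : ℝ, (2 / q * (√q * deriv liaSym (z * √q))) * ‖F z‖ ^ 2 : ℝ) : ℂ)
  rw [hdiff]
  have hparts' : ∫ z : ℝ, m z * v' z = -∫ z : ℝ, m' z * v z := hparts
  rw [hparts']
  have hreal : ∫ z : ℝ, m' z * v z
      = -(((∫ z : ℝ, (2 / q * (√q * deriv liaSym (z * √q))) * ‖∫ x : ℝ, f x * cexp (I * z * x)‖ ^ 2) : ℝ) : ℂ) := by
    rw [← Complex.ofReal_neg, ← integral_neg, ← integral_complex_ofReal]
    refine integral_congr_ae (Eventually.of_forall fun z => ?_)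
    simp only [hm'def, hvdef, hFdef, Complex.conj_mul']
    push_cast
    ring
  rw [hreal, Complex.inv_I]
  push_cast
  ring

/-! ## §5 Assembly with the physical-space virial identity; the band gain -/

/-- **BAND VIRIAL IDENTITY (model self operator, symbol side).**  For `q > 0`, `c : ℝ` and a continuous `Y ∈ L¹ ∩ L²(ℝ; ℂ)`
with `x·Y ∈ L¹`, writing `K_q(s) = (2q−s²)(s²+q)^{-5/2}` and `Ŷ(z) = ∫ Y(x)e^{izx}dx`:
`i∫_{ℝ²} K_q(τ−σ)Y(σ)conj Y(τ)(τ−c) + conj(i∫_{ℝ²} …) = −(1/(π√q))·∫ 𝔖′(z√q)|Ŷ(z)|² dz`.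
Since `2Re⟨i(2/q)Y, (τ−c)Y⟩ = 0` (p670953 `I_mul_real_add_conj`), this is `−2Re⟨ i·M_qY, (τ−c)Y ⟩` for the model self operator
`M_q = (2/q)·I − K_q∗` up to the model constant: the Mourre commutator of DESIGN-NOTE §4 with conjugate operator `τ − c`. [folklore] -/
theorem band_virial_identity {q : ℝ} (hq : 0 < q) {Y : ℝ → ℂ} (hYc : Continuous Y) (hY : Integrable Y)
    (hY2 : MemLp Y 2) (hxY : Integrable (fun x : ℝ => x • Y x)) (c : ℝ) :
    I * (∫ p : ℝ × ℝ, ((((2 * q - (p.1 - p.2) ^ 2) * (((p.1 - p.2) ^ 2 + q) ^ (5 / 2 : ℝ))⁻¹ : ℝ)) : ℂ)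
        * (Y p.2 * conj (Y p.1)) * ((p.1 - c : ℝ) : ℂ))
      + conj (I * ∫ p : ℝ × ℝ, ((((2 * q - (p.1 - p.2) ^ 2) * (((p.1 - p.2) ^ 2 + q) ^ (5 / 2 : ℝ))⁻¹ : ℝ)) : ℂ)
        * (Y p.2 * conj (Y p.1)) * ((p.1 - c : ℝ) : ℂ))
      = -((((1 / (π * √q)) * ∫ z : ℝ, deriv liaSym (z * √q) * ‖∫ x : ℝ, Y x * cexp (I * z * x)‖ ^ 2) : ℝ) : ℂ) := by
  -- the physical-space identity
  have hev : ∀ x : ℝ, (2 * q - (-x) ^ 2) * (((-x) ^ 2 + q) ^ (5 / 2 : ℝ))⁻¹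
      = (2 * q - x ^ 2) * ((x ^ 2 + q) ^ (5 / 2 : ℝ))⁻¹ := fun x => by rw [neg_sq]
  -- integrability of the weighted integrand: `K` bounded, `Y` and `(τ−c)Y` integrable
  have hwY : Integrable (fun τ : ℝ => ((τ - c : ℝ) : ℂ) * Y τ) := by
    have h1 : Integrable (fun τ : ℝ => (τ : ℂ) * Y τ) :=
      hxY.congr (Eventually.of_forall fun x => by simp [Complex.real_smul])
    have h2 : Integrable (fun τ : ℝ => (c : ℂ) * Y τ) := hY.const_mul _
    refine (h1.sub h2).congr (Eventually.of_forall fun τ => ?_)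
    simp only [Pi.sub_apply]
    push_cast; ring
  have hint : Integrable (fun p : ℝ × ℝ => (((2 * q - (p.1 - p.2) ^ 2) * (((p.1 - p.2) ^ 2 + q) ^ (5 / 2 : ℝ))⁻¹ : ℝ) : ℂ)
      * (Y p.2 * conj (Y p.1)) * ((p.1 - c : ℝ) : ℂ)) := by
    rw [Measure.volume_eq_prod]
    have hKm : AEStronglyMeasurable (fun p : ℝ × ℝ =>
        ((((2 * q - (p.1 - p.2) ^ 2) * (((p.1 - p.2) ^ 2 + q) ^ (5 / 2 : ℝ))⁻¹ : ℝ)) : ℂ)) (volume.prod volume) := by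
      refine Continuous.aestronglyMeasurable ?_
      exact Complex.continuous_ofReal.comp ((continuous_smoothingKernel hq).comp (continuous_fst.sub continuous_snd))
    have hq32 : 0 < q ^ (3 / 2 : ℝ) := Real.rpow_pos_of_pos hq _
    have hbase : Integrable (fun p : ℝ × ℝ => Y p.2 * conj (((p.1 - c : ℝ) : ℂ) * Y p.1)) (volume.prod volume) :=
      integrable_prod_mul_conj hY hwY
    refine ((hbase.bdd_mul hKm (c := 2 * (q ^ (3 / 2 : ℝ))⁻¹)) (Eventually.of_forall fun p => ?_)).congr
      (Eventually.of_forall fun p => ?_)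
    · rw [Complex.norm_real, Real.norm_eq_abs]
      refine (abs_smoothingKernel_le hq (p.1 - p.2)).trans ?_
      have hle : q ^ (3 / 2 : ℝ) ≤ ((p.1 - p.2) ^ 2 + q) ^ (3 / 2 : ℝ) :=
        Real.rpow_le_rpow hq.le (by nlinarith [sq_nonneg (p.1 - p.2)]) (by norm_num)
      have := inv_anti₀ hq32 hle
      linarith
    · simp only [map_mul, Complex.conj_ofReal]
      ring
  have hphys := kernel_virial_identity (fun s : ℝ => (2 * q - s ^ 2) * ((s ^ 2 + q) ^ (5 / 2 : ℝ))⁻¹) hev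
    (continuous_smoothingKernel hq) Y hYc c hint
  beta_reduce at hphys
  rw [hphys]
  -- the symbol side
  have hcomm := integral_prod_commutatorKernel hq hY hY2 hxY
  rw [Measure.volume_eq_prod, hcomm, ← mul_assoc, Complex.I_mul_I]
  have hsq : (2 / q * √q : ℝ) = 2 / √q := by
    have hs : √q ≠ 0 := (Real.sqrt_pos.mpr hq).ne'
    field_simp
    rw [Real.sq_sqrt hq.le]
  have hconst : ∀ S : ℝ, (1 / (2 * π)) * ((2 / q * √q) * S) = (1 / (π * √q)) * S := by
    intro S
    rw [hsq]
    have hs : √q ≠ 0 := (Real.sqrt_pos.mpr hq).ne'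
    field_simp
  have hpull : ∫ z : ℝ, (2 / q * (√q * deriv liaSym (z * √q))) * ‖∫ x : ℝ, Y x * cexp (I * z * x)‖ ^ 2
      = (2 / q * √q) * ∫ z : ℝ, deriv liaSym (z * √q) * ‖∫ x : ℝ, Y x * cexp (I * z * x)‖ ^ 2 := by
    rw [← integral_const_mul]
    refine integral_congr_ae (Eventually.of_forall fun z => ?_)
    simp only; ring
  rw [hpull, hconst]
  push_cast
  ring

/-- **THE BAND GAIN (model case of the Mourre estimate).**  If, in addition, `Ŷ` vanishes wherever `𝔖′(z√q) < σ₀`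
(frequency localisation in a slice where the symbol's slope is at least `σ₀`), then
`(1/(π√q))∫𝔖′(z√q)|Ŷ(z)|²dz ≥ (2σ₀/√q)·∫‖Y‖²` — by `|Ŷ|² ≥ 0` pointwise and Plancherel `(1/2π)∫|Ŷ|² = ∫‖Y‖²`. [folklore] -/
theorem band_virial_ge_of_slice {q σ₀ : ℝ} (hq : 0 < q) {Y : ℝ → ℂ} (hY : Integrable Y) (hY2 : MemLp Y 2)
    (hsupp : ∀ z : ℝ, deriv liaSym (z * √q) < σ₀ → ∫ x : ℝ, Y x * cexp (I * z * x) = 0) :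
    2 * σ₀ / √q * ∫ x : ℝ, ‖Y x‖ ^ 2
      ≤ (1 / (π * √q)) * ∫ z : ℝ, deriv liaSym (z * √q) * ‖∫ x : ℝ, Y x * cexp (I * z * x)‖ ^ 2 := by
  have hsq : 0 < √q := Real.sqrt_pos.mpr hq
  have hFi := integrable_norm_sq_unnormalisedTransform hY hY2
  -- pointwise: `σ₀|Ŷ|² ≤ 𝔖′(z√q)|Ŷ|²`
  have hpt : ∀ z : ℝ, σ₀ * ‖∫ x : ℝ, Y x * cexp (I * z * x)‖ ^ 2
      ≤ deriv liaSym (z * √q) * ‖∫ x : ℝ, Y x * cexp (I * z * x)‖ ^ 2 := by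
    intro z
    rcases lt_or_ge (deriv liaSym (z * √q)) σ₀ with h | h
    · rw [hsupp z h]; simp
    · exact mul_le_mul_of_nonneg_right h (by positivity)
  have hmeas : AEStronglyMeasurable (fun z : ℝ => deriv liaSym (z * √q)) volume :=
    ((measurable_deriv liaSym).comp (measurable_id.mul_const _)).aestronglyMeasurable
  have hSi : Integrable (fun z : ℝ => deriv liaSym (z * √q) * ‖∫ x : ℝ, Y x * cexp (I * z * x)‖ ^ 2) := by
    refine hFi.bdd_mul hmeas (c := π) (Eventually.of_forall fun z => ?_)
    rw [Real.norm_eq_abs]; exact abs_deriv_liaSym_le _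
  have hle : σ₀ * ∫ z : ℝ, ‖∫ x : ℝ, Y x * cexp (I * z * x)‖ ^ 2
      ≤ ∫ z : ℝ, deriv liaSym (z * √q) * ‖∫ x : ℝ, Y x * cexp (I * z * x)‖ ^ 2 := by
    rw [← integral_const_mul]
    exact integral_mono (hFi.const_mul _) hSi hpt
  -- Plancherel: `∫|Ŷ|² = 2π∫‖Y‖²`
  have hpl : ∫ z : ℝ, ‖∫ x : ℝ, Y x * cexp (I * z * x)‖ ^ 2 = 2 * π * ∫ x : ℝ, ‖Y x‖ ^ 2 := by
    have h1 := integral_norm_sq_fourier_eq_unnormalised Y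
    rw [Literature.Analysis.FunctionSpaces.integral_norm_sq_fourierIntegral_eq hY hY2] at h1
    have hπ : (0:ℝ) < 2 * π := Real.two_pi_pos
    field_simp at h1
    linarith
  rw [hpl] at hle
  have hπ : (0:ℝ) < π := Real.pi_pos
  calc 2 * σ₀ / √q * ∫ x : ℝ, ‖Y x‖ ^ 2 = (1 / (π * √q)) * (σ₀ * (2 * π * ∫ x : ℝ, ‖Y x‖ ^ 2)) := by
        field_simp
    _ ≤ (1 / (π * √q)) * ∫ z : ℝ, deriv liaSym (z * √q) * ‖∫ x : ℝ, Y x * cexp (I * z * x)‖ ^ 2 :=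
        mul_le_mul_of_nonneg_left hle (by positivity)

end Summit.NavierStokesRegularity.NavierStokesRegularity.Theorems.MatchedKernel

end
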